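import Literature.MathematicalPhysics.QuantumFieldTheory.Balaban1983to89.B9SectBStepFrameV5
import Literature.MathematicalPhysics.QuantumFieldTheory.Balaban1983to89.B9Ineq368L2F
import Literature.MathematicalPhysics.QuantumFieldTheory.Balaban1983to89.B9Ineq349L2HomReadings
import Literature.MathematicalPhysics.QuantumFieldTheory.Balaban1983to89.B9Ineq377L2Hom

/-!
# `Balaban1983to89.B9SectBL2GStepAtLettersV3` — [B9] Sect. B, THE `L²` LETTERS DICTIONARY OF THE BOND-SECTOR OPERATOR WITHOUT ITS DISPLAYED
# PRINTED INEQUALITY: `L2GFrame₃` (= `L2GFrame₂` with (3.77) REPLACED by the structured block-ℓ² Hom-readings of `Q′, Q′*, F′, F′*` through the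
# lattice of blocks) and ★★ `read377_of_l2GFrame₃` — (3.77) p. 406 in block-ℓ² for the concrete `P₁(A)` is now a THEOREM on the letters;
# `L2GFrame₃.toL2GFrame₂`, `stepL2Pos_of_l2GFrame₃`

T. Bałaban, *Propagators for lattice gauge theories in a background field*, Commun. Math. Phys. **99** (1985) 389–434
[`Balaban1985BackgroundPropagators`, "B9"]; [4] = T. Bałaban, *Propagators and renormalization transformations for lattice gauge theories. II*,
Commun. Math. Phys. **96** (1984) 223–250 [`Balaban1984PropagatorsII`].

statement-level skeleton of published theorems with citation tags; proofs where landed; nothing here is a claim about the Yang–Mills mass gap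

THE PRINTED LOCUS (verbatim).  (3.77) p. 406: *"|P₁(A)| ≦ O(1)α₁e^{−δd(y,y′)}"*, with (3.49) p. 399 (the entries of `R(U) = G′Q′*C⁻¹Q′G′`), (3.68) p. 403
(`P(U′U) = P(U) + P′(A)`), (3.70)∕(3.74) pp. 404–405 (`D_{U′U} − D_U`, `D*_{U′U} − D*_U`), (3.57) p. 402, (3.64)–(3.67) pp. 402–403; Theorem 3.2 (3.48) p. 398.

WHY THIS FILE (pub-ymgap N06 row 13).  `B9SectBL2GStepAtLettersV2.L2GFrame₂` (this seat, g6) framed the six (3.46) members of G(U′U) kernel-free but DISPLAYED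
one printed inequality, (3.77) in block-ℓ² for the concrete `P₁(A)` (`read377`).  Its proof from letters is now in the tree: `B9Ineq377L2Hom.ineq377_l2_concreteE`
(g5) fed by `B9Ineq349L2HomReadings.ineq349_l2Hom_of_readings` (the three (3.49) entries of `R₀(U)`, g6) and `B9Ineq368L2F.ineq368_l2_F` (the four (3.68)
entries of `F(A) = R₀(U′U) − R₀(U)` through 𝔅, g6).  THIS FILE is the frame-level instantiation: `L2GFrame₃` carries, instead of `read377`, the
structured block-ℓ² Hom-READINGS of the averaging letters `Q′(V)`, `Q′*(V)` ((3.19): diagonal, weights `w_c`, `w_s` with `w_s·w_c ≦ 1` — at an instance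
`(#Δ)^{∓1/2}` — and the volume-ratio transfer of `w_c` in the window shape of `GpFrame₂.hST`) and of the (3.57) variations `Q′(U′U) − Q′(U)`,
`Q′*(U′U) − Q′*(U)` ((3.59): `c_F·α₁·w`), plus the member-2 reading of G′ at U; `read377_of_l2GFrame₃` then PROVES the (3.77) field: r06's R1 uniform
theorems `thm34_Gp_uniform` (inverse identities of the G′ extension, `gop_eq`) and `thm34_Cinv_uniform` (C⁻¹(U′U) = its `Tinv` by `cop_eq`, WITH the (3.48)
kernel bound at U′U — legitimate on 𝔅, one point per block — turned into an entry bound), this lineage's `l2entries_ext_of_l2Frame₂` ∕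
`l2rightEntries_ext_of_l2Frame₂` (the block-ℓ² entries of G′(U′U)), the block-ℓ² (3.63) `ineq363_l2_vPrime` ∕ `hasL2Majorant_gp_vPrime`, the resolvent
identities (3.65), and the three bricks above.

WHAT IS IN THE FILE (0 sorry; standard axioms).  `entry_of_kerBound` (kernel bound w.r.t. the volume pairing ⇒ entry bound on 𝔅), `kappa377_le_one`
(the (3.77) constant is monotone in `α₁ ≦ 1`), `structure L2GFrame₃`, ★★ `read377_of_l2GFrame₃`, `L2GFrame₃.toL2GFrame₂`, ★ `stepL2Pos_of_l2GFrame₃`.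

HONEST SCOPE.  Hypothesis structure + bookkeeping; `L2GFrame₃` NOT shown inhabited; every field is a reading ∕ writing ∕ law of the kinds `GFrame₂`,
`CinvFrame₂`, `L2Frame₂` already carry (now in block-ℓ² and through 𝔅); nothing of [B9] asserted for Bałaban's operators; count-neutral; NOT a node
discharge; nothing continuum ∕ OS ∕ mass-gap ∕ Clay.  Cell `pub-ymgap` (HUMAN RULING D-0062), Track A node N06 [B9], N06-ASSIGNMENT row 13 (G-side `ℓ²`
route, GSIDE-L2-SPEC v4 §F), seat `pub-ymgap-dag-n06-c` (g6), 2026-08-27.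
-/

noncomputable section

open scoped BigOperators

namespace Literature.MathematicalPhysics.QuantumFieldTheory.Balaban1983to89.B9SectBL2GStepAtLettersV3

open Literature.MathematicalPhysics.QuantumFieldTheory.Balaban1983to89
open Literature.MathematicalPhysics.QuantumFieldTheory.Balaban1983to89.B6RandomWalk (HasMajorant Triangle254 Ineq261)
open Literature.MathematicalPhysics.QuantumFieldTheory.Balaban1983to89.B6RandomWalkL2 (HasL2Majorant hasL2Majorant_mono)
open Literature.MathematicalPhysics.QuantumFieldTheory.Balaban1983to89.B6RandomWalkL2Hom (HasL2MajorantHom)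
open Literature.MathematicalPhysics.QuantumFieldTheory.Balaban1983to89.B9Thm34Ext (toB6)
open Literature.MathematicalPhysics.QuantumFieldTheory.Balaban1983to89.B9Ineq347 (ScaleTransfer)
open Literature.MathematicalPhysics.QuantumFieldTheory.Balaban1983to89.B9Eq39Adjoint (covDstar)
open Literature.MathematicalPhysics.QuantumFieldTheory.Balaban1983to89.B9Eq352DivForm (tauB)
open Literature.MathematicalPhysics.QuantumFieldTheory.Balaban1983to89.B9Eq352DivFormLetters (conj)
open Literature.MathematicalPhysics.QuantumFieldTheory.Balaban1983to89.B9Eq352GradLetters (diffLetter)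
open Literature.MathematicalPhysics.QuantumFieldTheory.Balaban1983to89.B9Eq371GradLetters (bT bU)
open Literature.MathematicalPhysics.QuantumFieldTheory.Balaban1983to89.B9Eq360Vprime (gPrimeExtEnd)
open Literature.MathematicalPhysics.QuantumFieldTheory.Balaban1983to89.B9Eq360VprimeLetters (vPrimeConc)
open Literature.MathematicalPhysics.QuantumFieldTheory.Balaban1983to89.B9Eq376POneLetters (conjHom gradLin divLin)
open Literature.MathematicalPhysics.QuantumFieldTheory.Balaban1983to89.B9Thm34SectBUniformR1 (thm34_Gp_uniform thm34_Cinv_uniform)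
open Literature.MathematicalPhysics.QuantumFieldTheory.Balaban1983to89.B9FromB6 (EBlock L2Block)
open Literature.MathematicalPhysics.QuantumFieldTheory.Balaban1983to89.B9SectBStepWhole (StepPos StepL2Pos)
open Literature.MathematicalPhysics.QuantumFieldTheory.Balaban1983to89.B9SectBGpStepAtLettersV2 (GpFrame₂ CinvFrame₂)
open Literature.MathematicalPhysics.QuantumFieldTheory.Balaban1983to89.B9SectBGStepAtLettersV2 (GFrame₂)
open Literature.MathematicalPhysics.QuantumFieldTheory.Balaban1983to89.B9SectBL2StepAtLettersV2 (L2Frame₂ thetaL2 cVL2_le_one l2entries_ext_of_l2Frame₂)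
open Literature.MathematicalPhysics.QuantumFieldTheory.Balaban1983to89.B9SectBL2StepAtLettersV2Right (thetaL2R rateR rateR_pos
  l2rightEntries_ext_of_l2Frame₂)
open Literature.MathematicalPhysics.QuantumFieldTheory.Balaban1983to89.B9SectBL2GStepAtLettersV2 (L2GFrame₂ stepL2Pos_of_l2GFrame₂)
open Literature.MathematicalPhysics.QuantumFieldTheory.Balaban1983to89.B9Ineq363L2 (cVL2 cVL2_nonneg ineq363_l2_vPrime eq365_of_inverse
  hasL2Majorant_rate_mono)
open Literature.MathematicalPhysics.QuantumFieldTheory.Balaban1983to89.B9Ineq363L2Right (hasL2Majorant_gp_vPrime eq365_first_of_inverse)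
open Literature.MathematicalPhysics.QuantumFieldTheory.Balaban1983to89.B9Ineq377POne (kappa377 kappa377_nonneg)
open Literature.MathematicalPhysics.QuantumFieldTheory.Balaban1983to89.B9Ineq368PPrime (kappa349)
open Literature.MathematicalPhysics.QuantumFieldTheory.Balaban1983to89.B9Thm34GL2Entries (pOneConc)
open Literature.MathematicalPhysics.QuantumFieldTheory.Balaban1983to89.B9Ineq349L2HomReadings (ineq349_l2Hom_of_readings)
open Literature.MathematicalPhysics.QuantumFieldTheory.Balaban1983to89.B9Ineq368L2F (kappa368F ineq368_l2_F)
open Literature.MathematicalPhysics.QuantumFieldTheory.Balaban1983to89.B9Ineq377L2Hom (ineq377_l2_concreteE)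

universe u

/-! ## §0  Two small devices -/

/-- A (3.48)-type KERNEL bound w.r.t. the volume pairing `vol g n` on the lattice of blocks IS an ENTRY bound `|T(δ_{y′})(y)| ≦ c(Lʲη)⁻⁴E(y,y′)`
(`B9Thm34Inv.ker_le_iff`, `vol_inv`; the exponent `n` is immaterial). [cite: Balaban1985BackgroundPropagators, Thm 3.2 (3.48) p.398] -/
theorem entry_of_kerBound {g : B9.Geometry} [Fintype g.Site] [DecidableEq g.Site] (hlen : ∀ y : g.Site, 0 < g.len y)
    (T : Module.End ℝ (g.Site → ℝ)) {c : ℝ} {E : g.Site → g.Site → ℝ} (n : ℕ)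
    (h : ∀ y y' : g.Site, |B9Thm34Inv.ker (B9Thm34Inv.vol g n) T y y'| ≤ c * g.len y ^ (-(4 : ℝ)) * g.len y' ^ (-(n : ℝ)) * E y y') :
    ∀ y y' : g.Site, |T (Pi.single y' 1) y| ≤ c * (g.len y ^ 4)⁻¹ * E y y' := by
  intro y y'
  have hv : 0 < B9Thm34Inv.vol g n y' := B9Thm34Inv.vol_pos n hlen y'
  have h1 := h y y'
  rw [← B9Thm34Inv.vol_inv n hlen y', show c * g.len y ^ (-(4 : ℝ)) * (B9Thm34Inv.vol g n y')⁻¹ * E y y' =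
      (c * g.len y ^ (-(4 : ℝ)) * E y y') * (B9Thm34Inv.vol g n y')⁻¹ by ring] at h1
  have key : |B9Thm34Inv.entry T y y'| ≤ c * g.len y ^ (-(4 : ℝ)) * E y y' := (B9Thm34Inv.ker_le_iff _ hv T y _).1 h1
  have e4 : g.len y ^ (-(4 : ℝ)) = (g.len y ^ 4)⁻¹ := by
    rw [Real.rpow_neg (hlen y).le, ← Real.rpow_natCast]
    norm_num
  rw [e4] at key
  exact key

/-- The (3.77) constant `κ₃₇₇(c_E, κ_P, κ_{P′}, Λ, c, α₁)` is a polynomial in `α₁` with non-negative coefficients: `κ₃₇₇(…, α₁) ≦ κ₃₇₇(…, 1)` for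
`0 ≦ α₁ ≦ 1`. [cite: Balaban1985BackgroundPropagators, (3.77) p.406 (bookkeeping, ours)] -/
theorem kappa377_le_one {cE κP κP' Λ c α₁ : ℝ} (hcE : 0 ≤ cE) (hκP : 0 ≤ κP) (hκP' : 0 ≤ κP') (hΛ : 0 ≤ Λ) (hc : 0 ≤ c)
    (hα₁ : 0 ≤ α₁) (hα₁1 : α₁ ≤ 1) : kappa377 cE κP κP' Λ c α₁ ≤ kappa377 cE κP κP' Λ c 1 := by
  unfold kappa377
  have h1 : α₁ ^ 2 ≤ 1 ^ 2 := by nlinarith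
  have hΛc : 0 ≤ Λ * c * cE := by positivity
  have h2 : 2 * κP + cE * α₁ * κP * c + 2 * α₁ * κP' + cE * α₁ ^ 2 * κP' * c ≤
      2 * κP + cE * 1 * κP * c + 2 * 1 * κP' + cE * 1 ^ 2 * κP' * c := by
    have a1 : cE * α₁ * κP * c ≤ cE * 1 * κP * c := by
      have : 0 ≤ cE * κP * c := by positivity
      nlinarith
    have a2 : 2 * α₁ * κP' ≤ 2 * 1 * κP' := by nlinarith
    have a3 : cE * α₁ ^ 2 * κP' * c ≤ cE * 1 ^ 2 * κP' * c := by
      have : 0 ≤ cE * κP' * c := by positivity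
      nlinarith
    linarith
  nlinarith [mul_le_mul_of_nonneg_left h2 hΛc]

/-! ## §1  The letters dictionary without the displayed (3.77) -/

variable {I : Type} (c35 : ℝ) (geo : I → B9.Geometry) (bg : I → B9.Backgrounds)
  (Gp : ∀ i, B9.KernelFamily (geo i) (bg i))
  {𝔸 : Type u} [NormedRing 𝔸] [NormedAlgebra ℂ 𝔸] [CompleteSpace 𝔸] {ι : Type} [Fintype ι] [DecidableEq ι]
  (b : Module.Basis ι ℝ 𝔸) (κ : Type) [Fintype κ] [LinearOrder κ]
  (S : I → Type) [∀ i, Fintype (S i)] [∀ i, DecidableEq (S i)]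
  [∀ i, Fintype (geo i).Site] [∀ i, DecidableEq (geo i).Site] [∀ i, Nonempty (geo i).Site]

/-- **THE `L²` LETTERS DICTIONARY OF G(U′U) WITH THE (3.77) DATUM READ, NOT DISPLAYED** — `L2Frame₂` and `GFrame₂` (common parent `GpFrame₂`) plus:
the fields of `L2GFrame₂` except `read377` (`cLG … writeGL2`); the member-2 `L²` reading of G′ at U (`readL2_2`, as `SectBFrame₄`); and, replacing
`read377`, the STRUCTURED BLOCK-ℓ² Hom-READINGS through the lattice of blocks: `Q′(V) ≺₂ κc2·w_c(y)𝟙`, `Q′*(V) ≺₂ κs2·w_s(y)𝟙` for every configuration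
`V` ((3.19)), the (3.57) variations `Q′(U′U) − Q′(U) ≺₂ cF2·α₁·w_c𝟙`, `Q′*(U′U) − Q′*(U) ≺₂ cF2·α₁·w_s𝟙` on the class (3.37) ((3.59)), the weights' laws
`w_c, w_s ≧ 0`, `w_s·w_c ≦ 1`, and the volume-ratio transfer of `w_c` in the window shape of `GpFrame₂.hST` (constant `ΛCf δ α`, threshold `MST δ`).
A hypothesis structure; nothing asserted.
[cite: Balaban1985BackgroundPropagators, Thm 3.4 p.400 + Thm 3.3 p.399 + Thm 3.1 (3.46) p.398 + (3.19) p.393 + (3.57)–(3.59) p.402 + (3.77) p.406; Balaban1984PropagatorsII, Prop. 2.6 (2.140)–(2.141) p.247] -/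
structure L2GFrame₃ (GA : ∀ i, B9.KernelFamily (geo i) (bg i)) (Cinv : ∀ i, B9.SiteKernel (geo i) (bg i))
    extends L2Frame₂ c35 geo bg Gp b κ S, GFrame₂ c35 geo bg Gp b κ S GA Cinv where
  /-- the `L²` reading constant of (3.46) for G, the block-ℓ² constants of `Q(U)`∕`Q*(U)`, of `F₂`∕`F₂*` per `α₁`, of the weight `a`; the writing
  functions. -/
  cLG : ℝ
  κQb2 : ℝ
  cFb2 : ℝ
  abar2 : ℝ
  wLG : ℝ → ℝ → ℝ
  wLGδ : ℝ → ℝ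
  cLG_pos : 0 < cLG
  κQb2_nonneg : 0 ≤ κQb2
  cFb2_nonneg : 0 ≤ cFb2
  abar2_nonneg : 0 ≤ abar2
  wLG_pos : ∀ B δ : ℝ, 0 ≤ B → 0 < δ → 0 < wLG B δ
  wLGδ_pos : ∀ δ : ℝ, 0 < δ → 0 < wLGδ δ
  /-- (3.15) in block-ℓ²: `Q(U)`, `Q*(U)` have block-ℓ² majorants `κQb2·e^{−δd}` at every rate `0 < δ ≦ δcap`. -/
  hQb2 : ∀ i (U : (bg i).Cfg) (δ : ℝ), 0 < δ → δ ≤ δcap →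
    HasL2Majorant (g := toB6 (geo i) (Rr i) (Hp i)) (fun q : (κ × S i) × ι => blk i q.1.2) (Qb i U)
      (fun a a' => κQb2 * Real.exp (-(δ * (geo i).dist a a')))
  hQsb2 : ∀ i (U : (bg i).Cfg) (δ : ℝ), 0 < δ → δ ≤ δcap →
    HasL2Majorant (g := toB6 (geo i) (Rr i) (Hp i)) (fun q : (κ × S i) × ι => blk i q.1.2) (Qsb i U)
      (fun a a' => κQb2 * Real.exp (-(δ * (geo i).dist a a')))
  /-- (3.81) in block-ℓ²: `F₂(A)`, `F₂*(A) ≺₂ cFb2·α₁·e^{−δd}` at every rate `0 < δ ≦ δcap`, on the class (3.37). -/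
  hF₂2 : ∀ i (α₁ : ℝ) (U U' : (bg i).Cfg), 0 < α₁ → (bg i).Cplx337 α₁ U U' → ∀ δ : ℝ, 0 < δ → δ ≤ δcap →
    HasL2Majorant (g := toB6 (geo i) (Rr i) (Hp i)) (fun q : (κ × S i) × ι => blk i q.1.2) (F₂ i U U')
        (fun a a' => cFb2 * α₁ * Real.exp (-(δ * (geo i).dist a a'))) ∧
      HasL2Majorant (g := toB6 (geo i) (Rr i) (Hp i)) (fun q : (κ × S i) × ι => blk i q.1.2) (F₂s i U U')
        (fun a a' => cFb2 * α₁ * Real.exp (-(δ * (geo i).dist a a')))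
  /-- (3.24)∕(3.26) in block-ℓ²: the weight letter `a` is block-diagonal with block-ℓ² norm `≦ abar2·(Lʲη)^{−2}`. -/
  ha2 : ∀ i, HasL2Majorant (g := toB6 (geo i) (Rr i) (Hp i)) (fun q : (κ × S i) × ι => blk i q.1.2) (ab i)
    (fun a a' : (geo i).Site => if a = a' then abar2 * ((geo i).len a ^ 2)⁻¹ else 0)
  /-- READING (3.46) at U: the `L²` block of `GA` at (B₀, δ) ⇒ block-ℓ² majorants of the six bond letters of G(U) at (cLG·B₀, δ). -/
  readGL2 : ∀ i (α₀ : ℝ) (U : (bg i).Cfg) (B₀ δ : ℝ), MInv ≤ (geo i).M → 0 < α₀ → (geo i).M * α₀ ≤ aInv →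
    (bg i).Reg335 c35 α₀ U → 0 < B₀ → 0 < δ → L2Block (GA i) B₀ δ U →
    HasL2Majorant (g := toB6 (geo i) (Rr i) (Hp i)) (fun q : (κ × S i) × ι => blk i q.1.2) (Gb i U)
        (fun a a' => cLG * B₀ * (geo i).len a ^ 2 * Real.exp (-(δ * (geo i).dist a a'))) ∧
      (∀ k : κ ⊕ κ, HasL2Majorant (g := toB6 (geo i) (Rr i) (Hp i)) (fun q : (κ × S i) × ι => blk i q.1.2)
        (conj b (diffLetter (bT (T i)) (bU (coord i U)) ((((geo i).eta : ℂ))⁻¹) k) * Gb i U)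
        (fun a a' => cLG * B₀ * (geo i).len a * Real.exp (-(δ * (geo i).dist a a')))) ∧
      (∀ k : κ ⊕ κ, HasL2Majorant (g := toB6 (geo i) (Rr i) (Hp i)) (fun q : (κ × S i) × ι => blk i q.1.2)
        (Gb i U * conj b (diffLetter (bT (T i)) (bU (coord i U)) ((((geo i).eta : ℂ))⁻¹) k))
        (fun a a' => cLG * B₀ * (geo i).len a * Real.exp (-(δ * (geo i).dist a a')))) ∧
      (∀ k l : κ ⊕ κ, HasL2Majorant (g := toB6 (geo i) (Rr i) (Hp i)) (fun q : (κ × S i) × ι => blk i q.1.2)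
        (conj b (diffLetter (bT (T i)) (bU (coord i U)) ((((geo i).eta : ℂ))⁻¹) k) *
          conj b (diffLetter (bT (T i)) (bU (coord i U)) ((((geo i).eta : ℂ))⁻¹) l) * Gb i U)
        (fun a a' => cLG * B₀ * 1 * Real.exp (-(δ * (geo i).dist a a')))) ∧
      (∀ k l : κ ⊕ κ, HasL2Majorant (g := toB6 (geo i) (Rr i) (Hp i)) (fun q : (κ × S i) × ι => blk i q.1.2)
        (conj b (diffLetter (bT (T i)) (bU (coord i U)) ((((geo i).eta : ℂ))⁻¹) k) * Gb i U *
          conj b (diffLetter (bT (T i)) (bU (coord i U)) ((((geo i).eta : ℂ))⁻¹) l))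
        (fun a a' => cLG * B₀ * 1 * Real.exp (-(δ * (geo i).dist a a')))) ∧
      (∀ k l : κ ⊕ κ, HasL2Majorant (g := toB6 (geo i) (Rr i) (Hp i)) (fun q : (κ × S i) × ι => blk i q.1.2)
        (Gb i U * conj b (diffLetter (bT (T i)) (bU (coord i U)) ((((geo i).eta : ℂ))⁻¹) k) *
          conj b (diffLetter (bT (T i)) (bU (coord i U)) ((((geo i).eta : ℂ))⁻¹) l))
        (fun a a' => cLG * B₀ * 1 * Real.exp (-(δ * (geo i).dist a a'))))
  /-- WRITING (3.46) at U′U: block-ℓ² majorants of the six letters of G(U′U) (difference letters at the real U, the (3.37) correction being the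
  instance's, as in `GFrame₂.writeG342`) at (B, δ) ⇒ the whole `L²` block of `GA` at U′U with (wLG B δ, wLGδ δ), U′ in (3.37) at α₁ ≦ aW. -/
  writeGL2 : ∀ i (U U' : (bg i).Cfg) (α₁ B δ : ℝ), 0 < α₁ → α₁ ≤ aW → (bg i).Cplx337 α₁ U U' → 0 ≤ B → 0 < δ →
    HasL2Majorant (g := toB6 (geo i) (Rr i) (Hp i)) (fun q : (κ × S i) × ι => blk i q.1.2) (Gb i ((bg i).mul U' U))
        (fun a a' => B * (geo i).len a ^ 2 * Real.exp (-(δ * (geo i).dist a a'))) →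
    (∀ k : κ ⊕ κ, HasL2Majorant (g := toB6 (geo i) (Rr i) (Hp i)) (fun q : (κ × S i) × ι => blk i q.1.2)
        (conj b (diffLetter (bT (T i)) (bU (coord i U)) ((((geo i).eta : ℂ))⁻¹) k) * Gb i ((bg i).mul U' U))
        (fun a a' => B * (geo i).len a * Real.exp (-(δ * (geo i).dist a a')))) →
    (∀ k : κ ⊕ κ, HasL2Majorant (g := toB6 (geo i) (Rr i) (Hp i)) (fun q : (κ × S i) × ι => blk i q.1.2)
        (Gb i ((bg i).mul U' U) * conj b (diffLetter (bT (T i)) (bU (coord i U)) ((((geo i).eta : ℂ))⁻¹) k))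
        (fun a a' => B * (geo i).len a * Real.exp (-(δ * (geo i).dist a a')))) →
    (∀ k l : κ ⊕ κ, HasL2Majorant (g := toB6 (geo i) (Rr i) (Hp i)) (fun q : (κ × S i) × ι => blk i q.1.2)
        (conj b (diffLetter (bT (T i)) (bU (coord i U)) ((((geo i).eta : ℂ))⁻¹) k) *
          conj b (diffLetter (bT (T i)) (bU (coord i U)) ((((geo i).eta : ℂ))⁻¹) l) * Gb i ((bg i).mul U' U))
        (fun a a' => B * 1 * Real.exp (-(δ * (geo i).dist a a')))) →
    (∀ k l : κ ⊕ κ, HasL2Majorant (g := toB6 (geo i) (Rr i) (Hp i)) (fun q : (κ × S i) × ι => blk i q.1.2)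
        (conj b (diffLetter (bT (T i)) (bU (coord i U)) ((((geo i).eta : ℂ))⁻¹) k) * Gb i ((bg i).mul U' U) *
          conj b (diffLetter (bT (T i)) (bU (coord i U)) ((((geo i).eta : ℂ))⁻¹) l))
        (fun a a' => B * 1 * Real.exp (-(δ * (geo i).dist a a')))) →
    (∀ k l : κ ⊕ κ, HasL2Majorant (g := toB6 (geo i) (Rr i) (Hp i)) (fun q : (κ × S i) × ι => blk i q.1.2)
        (Gb i ((bg i).mul U' U) * conj b (diffLetter (bT (T i)) (bU (coord i U)) ((((geo i).eta : ℂ))⁻¹) k) *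
          conj b (diffLetter (bT (T i)) (bU (coord i U)) ((((geo i).eta : ℂ))⁻¹) l))
        (fun a a' => B * 1 * Real.exp (-(δ * (geo i).dist a a')))) →
    L2Block (GA i) (wLG B δ) (wLGδ δ) ((bg i).mul U' U)
  /-- READING (3.46)₂ at U per concrete difference letter (reading constant `cL`). -/
  readL2_2 : ∀ i (α₀ : ℝ) (U : (bg i).Cfg) (B₀ δ : ℝ), MInv ≤ (geo i).M → 0 < α₀ → (geo i).M * α₀ ≤ aInv →
    (bg i).Reg335 c35 α₀ U → 0 < B₀ → 0 < δ → L2Block (Gp i) B₀ δ U →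
    ∀ k : κ ⊕ κ, HasL2Majorant (g := toB6 (geo i) (Rr i) (Hp i)) (fun p : S i × ι => blk i p.1)
      (Gop i U * conj b (diffLetter (T i) (coord i U) ((((geo i).eta : ℂ))⁻¹) k))
      (fun a a' => cL * B₀ * (geo i).len a * Real.exp (-(δ * (geo i).dist a a')))
  /-- WRITING (3.46)₂ at U′U from block-ℓ² majorants of every `G′(U′U)∇♯_k` (letters at the real U). -/
  writeL2_2 : ∀ i (U U' : (bg i).Cfg) (α₁ B δ : ℝ), 0 < α₁ → α₁ ≤ aW → (bg i).Cplx337 α₁ U U' → 0 ≤ B → 0 < δ →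
    (∀ k : κ ⊕ κ, HasL2Majorant (g := toB6 (geo i) (Rr i) (Hp i)) (fun p : S i × ι => blk i p.1)
        (Gop i ((bg i).mul U' U) * conj b (diffLetter (T i) (coord i U) ((((geo i).eta : ℂ))⁻¹) k))
        (fun a a' => B * (geo i).len a * Real.exp (-(δ * (geo i).dist a a')))) →
    ∀ (lam : (geo i).Loc) (h : (geo i).Cut) (y y' : (geo i).Site), (geo i).cutIn h y → (geo i).suppIn lam y' →
      (Gp i).l2 2 ((bg i).mul U' U) lam h ≤
        wL B δ * B9.pref6 ((geo i).len y) 2 * (geo i).cutSup h * Real.exp (-(wLδ δ * (geo i).dist y y')) * (geo i).l2Norm lam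
  /-- the block-ℓ² constants of the averaging letters `Q′`, `Q′*` and of their (3.57) variations; the volume-transfer constant of `w_c`. -/
  κc2 : ℝ
  κs2 : ℝ
  cF2 : ℝ
  ΛCf : ℝ → ℝ → ℝ
  κc2_nonneg : 0 ≤ κc2
  κs2_nonneg : 0 ≤ κs2
  cF2_nonneg : 0 ≤ cF2
  ΛCf_nonneg : ∀ δ α : ℝ, 0 ≤ ΛCf δ α
  /-- per member: the weights of the structured readings (`w_c = (#Δ)^{−1/2}`, `w_s = (#Δ)^{1/2}` at an instance). -/
  wc : ∀ i, (geo i).Site → ℝ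
  ws : ∀ i, (geo i).Site → ℝ
  wc_nonneg : ∀ i (y : (geo i).Site), 0 ≤ wc i y
  ws_nonneg : ∀ i (y : (geo i).Site), 0 ≤ ws i y
  hprod : ∀ i (y : (geo i).Site), ws i y * wc i y ≤ 1
  /-- the volume-ratio transfer of `w_c` (p. 398 remark, exponent `γ = −d/2`), in the window shape of `GpFrame₂.hST`. -/
  hTC : ∀ i (δ α : ℝ), 0 < δ → δ ≤ δcap → 9 / 5000 ≤ α → MST δ ≤ (geo i).M →
    ∀ a a' : (geo i).Site, Real.exp (-(α * δ * (geo i).dist a a')) * wc i a' ≤ ΛCf δ α * wc i a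
  /-- (3.19) in block-ℓ² through 𝔅: the structured Hom-readings of `Q′(V)`, `Q′*(V)` at every configuration. -/
  hQc2 : ∀ i (V : (bg i).Cfg), HasL2MajorantHom (g := toB6 (geo i) (Rr i) (Hp i)) (fun p : S i × ι => blk i p.1)
    (fun z : (geo i).Site => z) (Qc i V) (fun a a' : (geo i).Site => if a = a' then κc2 * wc i a else 0)
  hQcs2 : ∀ i (V : (bg i).Cfg), HasL2MajorantHom (g := toB6 (geo i) (Rr i) (Hp i)) (fun z : (geo i).Site => z)
    (fun p : S i × ι => blk i p.1) (Qcs i V) (fun a a' : (geo i).Site => if a = a' then κs2 * ws i a else 0)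
  /-- (3.57)∕(3.59) in block-ℓ² through 𝔅: the variations `Q′(U′U) − Q′(U)`, `Q′*(U′U) − Q′*(U)` on the class (3.37). -/
  hFc2 : ∀ i (α₁ : ℝ) (U U' : (bg i).Cfg), 0 < α₁ → (bg i).Cplx337 α₁ U U' →
    HasL2MajorantHom (g := toB6 (geo i) (Rr i) (Hp i)) (fun p : S i × ι => blk i p.1) (fun z : (geo i).Site => z)
        (Qc i ((bg i).mul U' U) - Qc i U) (fun a a' : (geo i).Site => if a = a' then cF2 * α₁ * wc i a else 0) ∧
      HasL2MajorantHom (g := toB6 (geo i) (Rr i) (Hp i)) (fun z : (geo i).Site => z) (fun p : S i × ι => blk i p.1)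
        (Qcs i ((bg i).mul U' U) - Qcs i U) (fun a a' : (geo i).Site => if a = a' then cF2 * α₁ * ws i a else 0)

variable {c35 geo bg Gp b κ S}

/-! ## §2  (3.77) for the concrete `P₁(A)` in block-ℓ², PROVED on the letters of `L2GFrame₃` -/

set_option maxHeartbeats 3200000 in
/-- ★★ **(3.77) p. 406 FOR THE CONCRETE `P₁(A)`, IN BLOCK-ℓ², FROM THE LETTERS OF AN `L2GFrame₃`** — exactly the displayed field
`L2GFrame₂.read377`, now a THEOREM: for all inputs `(B₀, δ₀, B₁, δ₁) > 0` there are an M-threshold, an α₁-window, a constant `κ₇` and a rate `ρ₇`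
(before the member) such that at every (3.35)-regular U above the threshold carrying the (3.42), (3.46) blocks of `Gp` and the (3.48) kernel of `Cinv`,
and every U′ in (3.37) in the window, `pOneConc` at the frame's R-words has the block-ℓ² majorant `κ₇·α₁·(Lʲη)⁻²·e^{−ρ₇d}`.  Route: call rate
`δ′ = min(rate(min δ₀ δ₁), rateR(rate δ₀))`; r06's `thm34_Gp_uniform` (R1) for the inverse identities of the G′ extension (`gop_eq`), `thm34_Cinv_uniform`
(R1) for `C⁻¹(U′U)` (= its `Tinv` by `cop_eq`) WITH its (3.48) kernel bound at U′U (rate `9δ′/25`), turned into entry bounds (`entry_of_kerBound`);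
the block-ℓ² entries of G′(U′U) (`l2entries_ext_of_l2Frame₂`, `l2rightEntries_ext_of_l2Frame₂`); the block-ℓ² (3.63) both sides (`ineq363_l2_vPrime`,
`hasL2Majorant_gp_vPrime`, `θ ≦ Θα₁` by `cVL2_le_one`); (3.65) by `eq365_of_inverse` ∕ `eq365_first_of_inverse`; then `B9Ineq368L2F.ineq368_l2_F`
(the four (3.68) entries), `B9Ineq349L2HomReadings.ineq349_l2Hom_of_readings` (the three (3.49) entries) at the assembly rate `δ_F = 9δ′/25` and
`B9Ineq377L2Hom.ineq377_l2_concreteE`; `κ₃₇₇(…, α₁) ≦ κ₃₇₇(…, 1)` (`kappa377_le_one`).  (One long assembly of two r06 uniform theorems and a dozen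
bricks in a single theorem: the heartbeat limit is raised for it; 1 600 000 does not suffice on the farm, 3 200 000 does.)
[cite: Balaban1985BackgroundPropagators, (3.77) p.406 + (3.76) p.405 + (3.49) p.399 + (3.68) p.403 + (3.57)–(3.67) pp.402–403 + Thm 3.2 (3.48) p.398 + Thm 3.4 p.400; Balaban1984PropagatorsII, Lemma 2.1 p.234 + Prop. 2.6 (2.140)–(2.141) p.247] -/
theorem read377_of_l2GFrame₃ {GA : ∀ i, B9.KernelFamily (geo i) (bg i)} {Cinv : ∀ i, B9.SiteKernel (geo i) (bg i)}
    (F : L2GFrame₃ c35 geo bg Gp b κ S GA Cinv) :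
    ∀ (B₀ δ₀ B₁ δ₁ : ℝ), 0 < B₀ → 0 < δ₀ → 0 < B₁ → 0 < δ₁ →
    ∃ M₇ a₇ κ₇ ρ₇ : ℝ, 0 < M₇ ∧ 0 < a₇ ∧ 0 ≤ κ₇ ∧ 0 < ρ₇ ∧
      ∀ i (α₀ : ℝ) (U : (bg i).Cfg), M₇ ≤ (geo i).M → 0 < α₀ → (geo i).M * α₀ ≤ F.aInv → (bg i).Reg335 c35 α₀ U →
        EBlock (Gp i) B₀ δ₀ U → L2Block (Gp i) B₀ δ₀ U →
        (∀ y y' : (geo i).Site, |(Cinv i).ker U y y'| ≤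
          B₁ * ((geo i).len y) ^ (-(4 : ℝ)) * ((geo i).len y') ^ (-(F.dB : ℝ)) * Real.exp (-(δ₁ * (geo i).dist y y'))) →
        ∀ (α₁ : ℝ) (U' : (bg i).Cfg), 0 < α₁ → α₁ ≤ a₇ → (bg i).Cplx337 α₁ U U' →
          HasL2Majorant (g := toB6 (geo i) (F.Rr i) (F.Hp i)) (fun q : (κ × S i) × ι => F.blk i q.1.2)
            (pOneConc b (F.T i) (F.coord i U) (geo i).eta (F.expA i U U')
              (F.Gop i U ∘ₗ F.Qcs i U ∘ₗ F.Cop i U ∘ₗ F.Qc i U ∘ₗ F.Gop i U)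
              (F.Gop i ((bg i).mul U' U) ∘ₗ F.Qcs i ((bg i).mul U' U) ∘ₗ F.Cop i ((bg i).mul U' U) ∘ₗ F.Qc i ((bg i).mul U' U) ∘ₗ
                F.Gop i ((bg i).mul U' U)))
            (fun a a' => κ₇ * α₁ * ((geo i).len a ^ 2)⁻¹ * Real.exp (-(ρ₇ * (geo i).dist a a'))) := by
  intro B₀ δ₀ B₁ δ₁ hB₀ hδ₀ hB₁ hδ₁
  classical
  -- the block-ℓ² entries of G′(U′U) (left: members 0, 1; right: member 2), constants BEFORE the member
  obtain ⟨a₃, ha₃, B₃, hB₃, H3⟩ := l2entries_ext_of_l2Frame₂ F.toL2Frame₂ hB₀ hδ₀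
  obtain ⟨a₄, ha₄, B₄, hB₄, H4⟩ := l2rightEntries_ext_of_l2Frame₂ F.toL2Frame₂ F.readL2_2 hB₀ hδ₀
  -- the call rate δ′ (≤ δ₀, δ₁, δcap and ≤ both output rates of the G′(U′U) entries) and the assembly rate δF = 9δ′/25
  set δ' : ℝ := min (F.rate (min δ₀ δ₁)) (rateR (F.rate δ₀)) with hδ'
  have hrate0 : 0 < F.rate δ₀ := F.rate_pos hδ₀
  have hδ'0 : 0 < δ' := lt_min (F.rate_pos (lt_min hδ₀ hδ₁)) (rateR_pos hrate0)
  have hδ'c : δ' ≤ F.δcap := le_trans (min_le_left _ _) (F.rate_le_cap _)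
  have hδ'δ₀ : δ' ≤ δ₀ := le_trans (min_le_left _ _) (le_trans (F.rate_le _) (min_le_left _ _))
  have hδ'δ₁ : δ' ≤ δ₁ := le_trans (min_le_left _ _) (le_trans (F.rate_le _) (min_le_right _ _))
  have hδ'R : δ' ≤ rateR (F.rate δ₀) := min_le_right _ _
  have hδ'L : δ' ≤ (1 - 1 / 100) * (49 / 50 * F.rate δ₀) := by
    refine hδ'R.trans ?_; unfold rateR; nlinarith
  set δF : ℝ := 9 / 25 * δ' with hδF
  have hδF0 : 0 < δF := by positivity
  have hδFc : δF ≤ F.δcap := by rw [hδF]; nlinarith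
  have hδFδ' : δF ≤ δ' := by rw [hδF]; nlinarith
  -- r06's uniform clauses (R1) at the call rate: G′ (for the inverse identities) and C⁻¹
  have hBG : 0 < F.cR * B₀ := mul_pos F.cR_pos hB₀
  obtain ⟨a₁, ha₁, B', -, H⟩ := thm34_Gp_uniform b κ (F.d261 δ') δ' (F.cR * B₀) F.Cq F.a₀ F.d₀ F.M₂ (F.Λf δ')
    hBG F.Cq_nonneg F.a₀_nonneg F.M₂_nonneg hδ'0 (fun α hα => F.Λf_one_le _ α hδ'0 hα) F.hrepr
  obtain ⟨a₂, ha₂, H'⟩ := thm34_Cinv_uniform b κ (F.d261 δ') δ' F.κQ (F.cR * B₀) (F.cK * B₁) F.cF F.Cq F.a₀ F.d₀ F.M₂ (F.Λf δ') F.κQ_pos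
    hBG (mul_pos F.cK_pos hB₁) F.cF_pos F.Cq_nonneg F.a₀_nonneg F.M₂_nonneg hδ'0 (fun α hα => F.Λf_one_le _ α hδ'0 hα) F.hrepr
  -- frame-level constants of the assembly
  have hSb : 0 ≤ ∑ j, ‖b j‖ := Finset.sum_nonneg fun j _ => norm_nonneg _
  have hSb2 : 0 ≤ Real.sqrt (∑ j, ‖b j‖ ^ 2) := Real.sqrt_nonneg _
  set BL : ℝ := F.cL * B₀ with hBL
  have hBL0 : 0 < BL := mul_pos F.cL_pos hB₀
  set BG : ℝ := BL + B₃ + B₄ with hBGdef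
  have hBG0 : 0 ≤ BG := by positivity
  have hBLle : BL ≤ BG := by rw [hBGdef]; linarith
  have hB₃le : B₃ ≤ BG := by rw [hBGdef]; linarith [hBL0.le]
  have hB₄le : B₄ ≤ BG := by rw [hBGdef]; linarith [hBL0.le]
  set ΘV : ℝ := thetaL2 F.toL2Frame₂ B₀ δ' with hΘV
  set ΘW : ℝ := thetaL2R F.toL2Frame₂ B₀ δ' with hΘW
  have hΛ'1 : 1 ≤ F.Λf δ' (1 / 100) := F.Λf_one_le δ' _ hδ'0 (by norm_num)
  have hΛ'0 : 0 ≤ F.Λf δ' (1 / 100) := zero_le_one.trans hΛ'1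
  have hΘV0 : 0 ≤ ΘV := by
    rw [hΘV, thetaL2]
    have := cVL2_nonneg (d := Fintype.card κ) (nι := Fintype.card ι) (ρu := 1) zero_le_one F.a₀_nonneg F.Cq_nonneg F.M₂_nonneg
      hSb hSb2 (Real.exp_nonneg (δ' * F.d₀))
    have := B6RandomWalk.c1_nonneg (F.d261 δ') δ' (1 / 100)
    have := F.cL_pos
    positivity
  have hΘW0 : 0 ≤ ΘW := by
    rw [hΘW, thetaL2R]
    have := cVL2_nonneg (d := Fintype.card κ) (nι := Fintype.card ι) (ρu := 1) zero_le_one F.a₀_nonneg F.Cq_nonneg F.M₂_nonneg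
      hSb hSb2 (Real.exp_nonneg (δ' * F.d₀))
    have := B6RandomWalk.c1_nonneg (F.d261 δ') δ' (1 / 100)
    have := F.cL_pos
    have := F.M₂_nonneg
    positivity
  set BC : ℝ := F.cK * B₁ with hBC
  have hBC0 : 0 ≤ BC := (mul_pos F.cK_pos hB₁).le
  set BC' : ℝ := 2 * (F.cK * B₁) * B6.c1 (F.d261 δ') (2 / 5 * δ') (1 / 10) with hBC'
  have hBC'0 : 0 ≤ BC' := by have := B6RandomWalk.c1_nonneg (F.d261 δ') (2 / 5 * δ') (1 / 10); positivity
  set ΛF : ℝ := F.Λf δF (1 / 100) with hΛF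
  have hΛF1 : 1 ≤ ΛF := F.Λf_one_le δF _ hδF0 (by norm_num)
  set cFL : ℝ := B6.c1 (F.d261 δF) δF (1 / 100) with hcFL
  have hcFL0 : 0 ≤ cFL := B6RandomWalk.c1_nonneg _ _ _
  set ΛC0 : ℝ := F.ΛCf δF (1 / 100) with hΛC0
  have hΛC00 : 0 ≤ ΛC0 := F.ΛCf_nonneg _ _
  -- the (3.68) and (3.49) constants and the (3.77) constant at α₁ = 1
  set KPp : ℝ := (1 + Fintype.card κ) * kappa368F (F.Λf δF (1 / 100)) (B6.c1 (F.d261 δF) δF (1 / 100)) (F.ΛCf δF (1 / 100))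
      (F.ΛCf δF (1 / 100 * (48 / 50))) (F.ΛCf δF (1 / 100 * (45 / 50))) F.κc2 F.κs2 F.cF2 F.cF2 BG ΘV ΘW BC BC' with hKPp
  set KP : ℝ := (1 + Real.sqrt (Fintype.card κ)) * kappa349 1 BG (F.κs2 * F.κc2 * BC * ΛC0) ΛF cFL with hKP
  have hKP0 : 0 ≤ KP := by
    have := F.κc2_nonneg; have := F.κs2_nonneg
    rw [hKP]; unfold kappa349; positivity
  have hKPp0 : 0 ≤ KPp := by
    rw [hKPp]
    have hcard : (0 : ℝ) ≤ Fintype.card κ := Nat.cast_nonneg _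
    have : 0 ≤ kappa368F (F.Λf δF (1 / 100)) (B6.c1 (F.d261 δF) δF (1 / 100)) (F.ΛCf δF (1 / 100)) (F.ΛCf δF (1 / 100 * (48 / 50)))
        (F.ΛCf δF (1 / 100 * (45 / 50))) F.κc2 F.κs2 F.cF2 F.cF2 BG ΘV ΘW BC BC' := by
      have := F.ΛCf_nonneg δF (1 / 100); have := F.ΛCf_nonneg δF (1 / 100 * (48 / 50)); have := F.ΛCf_nonneg δF (1 / 100 * (45 / 50))
      have := zero_le_one.trans hΛF1; have := F.κc2_nonneg; have := F.κs2_nonneg; have := F.cF2_nonneg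
      unfold kappa368F B9Ineq368L2F.thetaM B9Ineq368L2F.thetaI B9Ineq368L2F.thetaC; positivity
    positivity
  set cE : ℝ := Real.sqrt (((Fintype.card κ + 1) * Fintype.card ι : ℕ) : ℝ) * (4 * (1 + Fintype.card κ) * (F.M₂ * ∑ j, ‖b j‖) *
    Real.exp (21 / 25 * δF * F.d₀)) with hcE
  have hcE0 : 0 ≤ cE := by rw [hcE]; have := F.M₂_nonneg; positivity
  set κ₇ : ℝ := kappa377 cE KP KPp ΛF cFL 1 with hκ₇
  have hκ₇0 : 0 ≤ κ₇ := kappa377_nonneg hcE0 hKP0 hKPp0 (zero_le_one.trans hΛF1) hcFL0 zero_le_one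
  -- thresholds and the α₁-window
  set a : ℝ := min (min a₁ a₂) (min (min a₃ a₄) (1 / 4)) with ha_def
  have ha0 : 0 < a := lt_min (lt_min ha₁ ha₂) (lt_min (lt_min ha₃ ha₄) (by norm_num))
  refine ⟨max (max (F.Mthr δ') (F.Mthr δF)) (F.Mthr (F.rate δ₀)), a, κ₇, 4 / 5 * δF, lt_max_of_lt_left (lt_max_of_lt_left (F.Mthr_pos _)),
    ha0, hκ₇0, by positivity, ?_⟩
  intro i α₀ U hM0 hα₀ hMa hU hE hL2 hKer α₁ U' hα₁ ha hU'
  have hM' : F.Mthr δ' ≤ (geo i).M := le_trans (le_trans (le_max_left _ _) (le_max_left _ _)) hM0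
  have hMF : F.Mthr δF ≤ (geo i).M := le_trans (le_trans (le_max_right _ _) (le_max_left _ _)) hM0
  have hM3 : F.Mthr (F.rate δ₀) ≤ (geo i).M := le_trans (le_max_right _ _) hM0
  have hM : F.MInv ≤ (geo i).M := F.MInv_le_of_Mthr_le hM'
  have ha1 : α₁ ≤ a₁ := ha.trans ((min_le_left _ _).trans (min_le_left _ _))
  have ha2 : α₁ ≤ a₂ := ha.trans ((min_le_left _ _).trans (min_le_right _ _))
  have ha3 : α₁ ≤ a₃ := ha.trans ((min_le_right _ _).trans ((min_le_left _ _).trans (min_le_left _ _)))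
  have ha4 : α₁ ≤ a₄ := ha.trans ((min_le_right _ _).trans ((min_le_left _ _).trans (min_le_right _ _)))
  have haq : α₁ ≤ 1 / 4 := ha.trans ((min_le_right _ _).trans (min_le_right _ _))
  have hα1 : α₁ ≤ 1 := haq.trans (by norm_num)
  have hw2 : ∀ a : (geo i).Site, 0 ≤ (geo i).len a ^ 2 := fun a => sq_nonneg _
  have hw1 : ∀ a : (geo i).Site, 0 ≤ (geo i).len a := fun a => (F.len_pos i a).le
  -- the letters at U: inverse identities, sup readings for r06, the class (3.37), (3.57)
  obtain ⟨hΔG, hGΔ⟩ := F.reg_inv i α₀ U hM hα₀ hMa hU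
  obtain ⟨h1, h2, h3, -⟩ := F.read342_le i α₀ U hM hα₀ hMa hU hB₀ hδ₀ hδ'δ₀ hE
  obtain ⟨hkF, hsF, h337s, h337F, h337B, hA, hAτ⟩ := F.cplx i α₁ U U' hα₁ hU'
  obtain ⟨hQm, hQsm⟩ := F.q_mul i α₁ U U' hα₁ hU'
  obtain ⟨hFc, hFcs⟩ := F.hF i α₁ U U' hα₁ hU'
  -- the G′ clause: the family's G′(U′U) is r06's extension
  obtain ⟨hinv1, hinv2, -, -⟩ := H (F.T i) (F.coord i U) (F.blk i) (F.kQ i U) (F.sQ i U) (F.cfun i) (F.w i U)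
    (F.dist_nonneg i) (F.triangle i) (F.dist_self i) (F.dist_comm i) (F.len_pos i) (F.eta_le_len i) (F.eta_pos i)
    (F.h261_of i hδ'0 hδ'c hM') (F.hST_of i hδ'0 hδ'c hM') (F.unitary i U)
    (F.stencilB i) (F.stencilF i) (F.stencil0 i) (F.w_nonneg i U) (F.card_w i U) (F.hkQ i U) (F.hsQ i U) (F.hcfun i)
    hΔG hGΔ h1 h2 h3 α₁ hα₁.le ha1 (F.expA i U U') (F.kF i U U') (F.sF i U U')
    hkF hsF h337s h337F h337B hA hAτ
  have hG := F.gop_eq i ((bg i).mul U' U) _ _ (F.mul_law i α₁ U U' hα₁ hU') hinv1 hinv2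
  -- the C⁻¹ clause: r06's inverse at U′U with its (3.48) kernel bound
  have hK := F.readKer i α₀ U B₁ δ₁ hM hα₀ hMa hU hB₁ hδ₁ hKer
  have hK' : ∀ y y' : (geo i).Site, |B9Thm34Inv.ker (B9Thm34Inv.vol (geo i) F.dB) (F.Cop i U) y y'| ≤
      F.cK * B₁ * (geo i).len y ^ (-(4 : ℝ)) * (geo i).len y' ^ (-(F.dB : ℝ)) * Real.exp (-(δ' * (geo i).dist y y')) := by
    intro y y'
    refine (hK y y').trans (mul_le_mul_of_nonneg_left (Real.exp_le_exp.2 ?_) ?_)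
    · exact neg_le_neg (mul_le_mul_of_nonneg_right hδ'δ₁ (F.dist_nonneg i y y'))
    · exact mul_nonneg (mul_nonneg (mul_pos F.cK_pos hB₁).le (Real.rpow_nonneg (F.len_pos i y).le _))
        (Real.rpow_nonneg (F.len_pos i y').le _)
  have hK'' := B9SectBGpStepAtLettersV2.kerBound_exp_change (F.len_pos i) (F.Cop i U) F.dB (F.d261 δ') hK'
  obtain ⟨Tinv, hT1, hT2, hker⟩ := H' (F.T i) (F.coord i U) (F.blk i) (F.kQ i U) (F.sQ i U) (F.cfun i) (F.w i U)
    (F.dist_nonneg i) (F.triangle i) (F.dist_self i) (F.dist_comm i) (F.len_pos i) (F.eta_le_len i) (F.eta_pos i)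
    (F.h261_of i hδ'0 hδ'c hM') (F.hST_of i hδ'0 hδ'c hM') (F.unitary i U)
    (F.stencilB i) (F.stencilF i) (F.stencil0 i) (F.w_nonneg i U) (F.card_w i U) (F.hkQ i U) (F.hsQ i U) (F.hcfun i)
    h1 h2 (F.hQc i U) (F.hQcs i U) (F.reg_cinv i α₀ U hM hα₀ hMa hU) hK'' α₁ hα₁.le ha2
    (F.expA i U U') (F.kF i U U') (F.sF i U U') hkF hsF h337s hA hAτ hQm hQsm hFc hFcs
  rw [← hG] at hT1 hT2
  have hC := F.cop_eq i ((bg i).mul U' U) _ Tinv rfl hT1 hT2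
  rw [← hC] at hker hT1
  -- entry bounds of C⁻¹(U) and C⁻¹(U′U) on 𝔅 at the assembly rate
  have h348 := entry_of_kerBound (F.len_pos i) (F.Cop i U) (F.d261 δ') hK''
  have h348' := entry_of_kerBound (F.len_pos i) (F.Cop i ((bg i).mul U' U)) (F.d261 δ') hker
  have hw4i : ∀ a : (geo i).Site, 0 ≤ ((geo i).len a ^ 4)⁻¹ := fun a => inv_nonneg.mpr (by positivity)
  have h348F : ∀ y y' : (geo i).Site, |F.Cop i U (Pi.single y' 1) y| ≤ BC * ((geo i).len y ^ 4)⁻¹ * Real.exp (-(δF * (geo i).dist y y')) :=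
    fun y y' => (h348 y y').trans (mul_le_mul_of_nonneg_left
      (Real.exp_le_exp.2 (neg_le_neg (mul_le_mul_of_nonneg_right hδFδ' (F.dist_nonneg i y y')))) (mul_nonneg hBC0 (hw4i y)))
  have hδF9 : δF ≤ 9 / 25 * δ' := le_rfl
  have h348F' : ∀ y y' : (geo i).Site, |F.Cop i ((bg i).mul U' U) (Pi.single y' 1) y| ≤
      BC' * ((geo i).len y ^ 4)⁻¹ * Real.exp (-(δF * (geo i).dist y y')) :=
    fun y y' => (h348' y y').trans (le_of_eq (by rw [hBC', hδF]))
  -- Theorem 3.1's L² members of G′ at U and the entries of G′(U′U), all lowered to the assembly rate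
  obtain ⟨l0, l1⟩ := F.readL2 i α₀ U B₀ δ₀ hM hα₀ hMa hU hB₀ hδ₀ hL2
  have r2 := F.readL2_2 i α₀ U B₀ δ₀ hM hα₀ hMa hU hB₀ hδ₀ hL2
  obtain ⟨e0, e1⟩ := H3 i α₀ U hM3 hα₀ hMa hU hE hL2 α₁ U' hα₁ ha3 hU'
  have e2 := H4 i α₀ U hM3 hα₀ hMa hU hE hL2 α₁ U' hα₁ ha4 hU'
  have hδFδ₀ : δF ≤ δ₀ := hδFδ'.trans hδ'δ₀
  have hδFL : δF ≤ (1 - 1 / 100) * (49 / 50 * F.rate δ₀) := hδFδ'.trans hδ'L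
  have hδFR : δF ≤ rateR (F.rate δ₀) := hδFδ'.trans hδ'R
  have low := fun (A : ℝ) (w : (geo i).Site → ℝ) (hA : 0 ≤ A) (hw : ∀ a, 0 ≤ w a) {ρ r : ℝ} (h : ρ ≤ r)
      {T₀ : Module.End ℝ (S i × ι → ℝ)}
      (hT : HasL2Majorant (g := toB6 (geo i) (F.Rr i) (F.Hp i)) (fun p : S i × ι => F.blk i p.1) T₀
        (fun a a' => A * w a * Real.exp (-(r * (geo i).dist a a')))) =>
    hasL2Majorant_rate_mono (R := F.Rr i) (H := F.Hp i) (fun p : S i × ι => F.blk i p.1) A w hA hw h (F.dist_nonneg i) hT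
  have up := fun {A : ℝ} (w : (geo i).Site → ℝ) (hw : ∀ a, 0 ≤ w a) (hA : A ≤ BG) {r : ℝ} {T₀ : Module.End ℝ (S i × ι → ℝ)}
      (hT : HasL2Majorant (g := toB6 (geo i) (F.Rr i) (F.Hp i)) (fun p : S i × ι => F.blk i p.1) T₀
        (fun a a' => A * w a * Real.exp (-(r * (geo i).dist a a')))) =>
    hasL2Majorant_mono (g := toB6 (geo i) (F.Rr i) (F.Hp i)) _ hT fun a a' =>
      mul_le_mul_of_nonneg_right (mul_le_mul_of_nonneg_right hA (hw a)) (Real.exp_nonneg _)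
  have hG0 := up (fun a => (geo i).len a ^ 2) hw2 hBLle (low BL (fun a => (geo i).len a ^ 2) hBL0.le hw2 hδFδ₀ l0)
  have hG1 := fun μ : κ => up (fun a => (geo i).len a) hw1 hBLle (low BL (fun a => (geo i).len a) hBL0.le hw1 hδFδ₀ (l1 (Sum.inl μ)))
  have hG2 := fun ν : κ => up (fun a => (geo i).len a) hw1 hBLle (low BL (fun a => (geo i).len a) hBL0.le hw1 hδFδ₀ (r2 (Sum.inr ν)))
  have hGt0 := up (fun a => (geo i).len a ^ 2) hw2 hB₃le (low B₃ (fun a => (geo i).len a ^ 2) hB₃ hw2 hδFL e0)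
  have hGt1 := fun μ : κ => up (fun a => (geo i).len a) hw1 hB₃le (low B₃ (fun a => (geo i).len a) hB₃ hw1 hδFL (e1 (Sum.inl μ)))
  have hGt2 := fun ν : κ => up (fun a => (geo i).len a) hw1 hB₄le (low B₄ (fun a => (geo i).len a) hB₄ hw1 hδFR (e2 (Sum.inr ν)))
  -- the block-ℓ² (3.63) both sides at the call rate δ′ (inputs lowered to δ′, output 49δ′/50 ≥ δF)
  have l0' := low BL (fun a => (geo i).len a ^ 2) hBL0.le hw2 hδ'δ₀ l0
  have l1' := fun k => low BL (fun a => (geo i).len a) hBL0.le hw1 hδ'δ₀ (l1 k)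
  have r2' := fun k => low BL (fun a => (geo i).len a) hBL0.le hw1 hδ'δ₀ (r2 k)
  have h261β : Ineq261 (F.d261 δ') (toB6 (geo i) (F.Rr i) (F.Hp i)) δ' (1 / 100) := F.h261_of i hδ'0 hδ'c hM' (1 / 100) (by norm_num) (by norm_num)
  obtain ⟨sT1, sT2, sT1i, sT2i, -, -⟩ := F.hST_of i hδ'0 hδ'c hM' (1 / 100) (by norm_num)
  have hsmall4 : ∀ y : (geo i).Site, (geo i).eta * (α₁ * ((geo i).len y)⁻¹) ≤ 1 / 4 := by
    intro y
    have hl := F.len_pos i y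
    have h1 : (geo i).eta * ((geo i).len y)⁻¹ ≤ 1 := by
      rw [← div_eq_mul_inv]; exact (div_le_one hl).mpr (F.eta_le_len i y)
    calc (geo i).eta * (α₁ * ((geo i).len y)⁻¹) = α₁ * ((geo i).eta * ((geo i).len y)⁻¹) := by ring
      _ ≤ α₁ * 1 := mul_le_mul_of_nonneg_left h1 hα₁.le
      _ ≤ 1 / 4 := by rw [mul_one]; exact haq
  have hr : 49 / 50 * δ' + (1 / 100 + 1 / 100) * δ' ≤ δ' := by nlinarith
  have hW := ineq363_l2_vPrime (Rr := F.Rr i) (H := F.Hp i) b (F.T i) (F.coord i U) (F.blk i) (F.d261 δ') (F.eta_pos i)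
    (F.expA i U U') (F.kQ i U) (F.kF i U U') (F.sQ i U) (F.sF i U U') (F.cfun i) (F.w i U) 1 F.d₀ F.M₂ F.Cq F.a₀
    δ' δ' (1 / 100) (1 / 100) (49 / 50 * δ') (F.Λf δ' (1 / 100)) BL α₁
    hBL0.le hα₁.le hΛ'0 (by positivity) (by norm_num) (by norm_num) hδ'0.le hδ'0.le hr
    (F.dist_nonneg i) (F.triangle i) (F.len_pos i) h261β sT1 sT2 F.M₂_nonneg F.hrepr hsmall4
    (fun μ x => ⟨hA μ x, hAτ μ μ x⟩) (fun μ x => h337s μ μ x) (fun μ x => F.unitary i U μ x)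
    (fun μ x => ⟨F.stencilF i μ x, F.stencilB i μ x⟩) (F.stencil0 i)
    (F.w_nonneg i U) (F.card_w i U) F.Cq_nonneg F.a₀_nonneg (F.hkQ i U) hkF (F.hsQ i U) hsF (F.hcfun i) l0' l1'
  have hMV := hasL2Majorant_gp_vPrime (Rr := F.Rr i) (H := F.Hp i) b (F.T i) (F.coord i U) (F.blk i) (F.d261 δ') (F.eta_pos i)
    (F.expA i U U') (F.kQ i U) (F.kF i U U') (F.sQ i U) (F.sF i U U') (F.cfun i) (F.w i U) 1 F.d₀ F.M₂ F.Cq F.a₀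
    δ' δ' (1 / 100) (1 / 100) (49 / 50 * δ') (F.Λf δ' (1 / 100)) BL α₁
    hBL0.le hα₁.le hΛ'0 (by positivity) (by norm_num) (by norm_num) hδ'0.le hδ'0.le hr
    (F.dist_nonneg i) (F.triangle i) (F.len_pos i) h261β sT1i sT2i F.M₂_nonneg F.hrepr hsmall4
    (fun μ x => ⟨hA μ x, hAτ μ μ x⟩) (fun μ x => h337s μ μ x) (fun μ x => h337F μ μ x) h337B (fun μ x => F.unitary i U μ x)
    (fun μ x => ⟨F.stencilF i μ x, F.stencilB i μ x⟩) (F.stencil0 i)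
    (F.w_nonneg i U) (F.card_w i U) F.Cq_nonneg F.a₀_nonneg (F.hkQ i U) hkF (F.hsQ i U) hsF (F.hcfun i) l0' r2'
  -- θ ≤ Θ·α₁ on both sides (cVL2 monotone in α₁ ≤ 1), then lowered to δF
  have hcv := cVL2_le_one (dκ := Fintype.card κ) (nι := Fintype.card ι) (E₀ := Real.exp (δ' * F.d₀)) hα1 F.a₀_nonneg
    F.Cq_nonneg F.M₂_nonneg hSb hSb2 (Real.exp_nonneg _)
  have hρF : δF ≤ 49 / 50 * δ' := by rw [hδF]; nlinarith
  have hVG : HasL2Majorant (g := toB6 (geo i) (F.Rr i) (F.Hp i)) (fun p : S i × ι => F.blk i p.1)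
      (conj b (vPrimeConc (F.T i) (F.coord i U) (geo i).eta (F.expA i U U') (F.blk i) (F.kQ i U) (F.kF i U U') (F.sQ i U)
        (F.sF i U U') (F.cfun i)) * F.Gop i U) (fun a a' => ΘV * α₁ * Real.exp (-(δF * (geo i).dist a a'))) := by
    refine hasL2Majorant_mono (g := toB6 (geo i) (F.Rr i) (F.Hp i)) _ hW fun a a' => ?_
    have hpre : 0 ≤ 2 * BL * F.Λf δ' (1 / 100) * B6.c1 (F.d261 δ') δ' (1 / 100) := by
      have := B6RandomWalk.c1_nonneg (F.d261 δ') δ' (1 / 100); positivity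
    have hθ : 2 * BL * F.Λf δ' (1 / 100) * B6.c1 (F.d261 δ') δ' (1 / 100) *
        cVL2 (Fintype.card κ) (Fintype.card ι) 1 α₁ F.a₀ F.Cq F.M₂ (∑ j, ‖b j‖) (Real.sqrt (∑ j, ‖b j‖ ^ 2)) (Real.exp (δ' * F.d₀)) ≤ ΘV := by
      rw [hΘV, thetaL2]; exact mul_le_mul_of_nonneg_left hcv hpre
    have hE : Real.exp (-(49 / 50 * δ' * (geo i).dist a a')) ≤ Real.exp (-(δF * (geo i).dist a a')) :=
      Real.exp_le_exp.2 (neg_le_neg (mul_le_mul_of_nonneg_right hρF (F.dist_nonneg i a a')))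
    calc _ ≤ ΘV * α₁ * Real.exp (-(49 / 50 * δ' * (geo i).dist a a')) :=
          mul_le_mul_of_nonneg_right (mul_le_mul_of_nonneg_right hθ hα₁.le) (Real.exp_nonneg _)
      _ ≤ _ := mul_le_mul_of_nonneg_left hE (mul_nonneg hΘV0 hα₁.le)
  have hGV : HasL2Majorant (g := toB6 (geo i) (F.Rr i) (F.Hp i)) (fun p : S i × ι => F.blk i p.1)
      (F.Gop i U * conj b (vPrimeConc (F.T i) (F.coord i U) (geo i).eta (F.expA i U U') (F.blk i) (F.kQ i U) (F.kF i U U') (F.sQ i U)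
        (F.sF i U U') (F.cfun i))) (fun a a' => ΘW * α₁ * Real.exp (-(δF * (geo i).dist a a'))) := by
    refine hasL2Majorant_mono (g := toB6 (geo i) (F.Rr i) (F.Hp i)) _ hMV fun a a' => ?_
    have hpre : 0 ≤ BL * F.Λf δ' (1 / 100) * B6.c1 (F.d261 δ') δ' (1 / 100) := by
      have := B6RandomWalk.c1_nonneg (F.d261 δ') δ' (1 / 100); positivity
    have hθ : BL * F.Λf δ' (1 / 100) * B6.c1 (F.d261 δ') δ' (1 / 100) *
        (cVL2 (Fintype.card κ) (Fintype.card ι) 1 α₁ F.a₀ F.Cq F.M₂ (∑ j, ‖b j‖) (Real.sqrt (∑ j, ‖b j‖ ^ 2)) (Real.exp (δ' * F.d₀)) +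
          2 * Fintype.card κ * (2 * (1 : ℝ) ^ 2 * F.M₂ * (∑ j, ‖b j‖) * Real.sqrt ((1 * Fintype.card ι : ℕ) : ℝ) * Real.exp (δ' * F.d₀))) ≤ ΘW := by
      rw [hΘW, thetaL2R]; exact mul_le_mul_of_nonneg_left (add_le_add hcv le_rfl) hpre
    have hE : Real.exp (-(49 / 50 * δ' * (geo i).dist a a')) ≤ Real.exp (-(δF * (geo i).dist a a')) :=
      Real.exp_le_exp.2 (neg_le_neg (mul_le_mul_of_nonneg_right hρF (F.dist_nonneg i a a')))
    calc _ ≤ ΘW * α₁ * Real.exp (-(49 / 50 * δ' * (geo i).dist a a')) :=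
          mul_le_mul_of_nonneg_right (mul_le_mul_of_nonneg_right hθ hα₁.le) (Real.exp_nonneg _)
      _ ≤ _ := mul_le_mul_of_nonneg_left hE (mul_nonneg hΘW0 hα₁.le)
  -- (3.65): the resolvent identities of the family's own G′(U′U)
  have h365 := eq365_of_inverse hΔG hinv2
  have h365' := eq365_first_of_inverse hGΔ hinv1
  rw [← hG] at h365 h365'
  -- Lemma 2.1 and the transfers at the assembly rate, the structured readings
  have h261F := F.h261_of i hδF0 hδFc hMF
  have hSTF : ∀ α : ℝ, 9 / 5000 ≤ α →
      ScaleTransfer (geo i) δF α (F.Λf δF α) (fun a => (geo i).len a) ∧ ScaleTransfer (geo i) δF α (F.Λf δF α) (fun a => (geo i).len a ^ 2) ∧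
      ScaleTransfer (geo i) δF α (F.Λf δF α) (fun a => ((geo i).len a ^ 4)⁻¹) := by
    intro α hα
    obtain ⟨t1, t2, -, -, t4, -⟩ := F.hST_of i hδF0 hδFc hMF α hα
    exact ⟨t1, t2, t4⟩
  have hTCF : ∀ α : ℝ, 9 / 5000 ≤ α → ∀ a a' : (geo i).Site, Real.exp (-(α * δF * (geo i).dist a a')) * F.wc i a' ≤ F.ΛCf δF α * F.wc i a :=
    fun α hα => F.hTC i δF α hδF0 hδFc hα (F.MST_le_of_Mthr_le hMF)
  obtain ⟨hFc2, hFcs2⟩ := F.hFc2 i α₁ U U' hα₁ hU'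
  -- ★ the four (3.68) entries of F(A)
  have h68 := ineq368_l2_F (R := F.Rr i) (H := F.Hp i) b (F.T i) (F.coord i U) (F.blk i) (F.d261 δF) ((((geo i).eta : ℂ))⁻¹) δF BG ΘV ΘW
    F.κc2 F.κs2 F.cF2 F.cF2 BC BC' α₁ (F.Λf δF) (F.ΛCf δF) (F.wc i) (F.ws i) hδF0 hBG0 hΘV0 hΘW0 F.κc2_nonneg F.κs2_nonneg F.cF2_nonneg
    F.cF2_nonneg hBC0 hBC'0 hα₁.le (fun α hα => F.Λf_one_le δF α hδF0 hα) (fun α => F.ΛCf_nonneg δF α) (F.wc_nonneg i) (F.ws_nonneg i)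
    (F.hprod i) (F.dist_nonneg i) (F.dist_comm i) (F.triangle i) (F.len_pos i) h261F hSTF hTCF h365 h365' hG0 hG1 hGt0 hGt1 hGt2 hVG hGV
    (F.hQc2 i U) (F.hQc2 i ((bg i).mul U' U)) (F.hQcs2 i U) (F.hQcs2 i ((bg i).mul U' U)) hFc2 hFcs2 h348F h348F'
    (F.reg_cinv i α₀ U hM hα₀ hMa hU) hT1
  obtain ⟨hPp, hDPp, hPpDs, hDPpDs⟩ := h68
  -- ★ the three (3.49) entries of R₀(U) from the readings
  obtain ⟨f1, f2, -, -, f4, -⟩ := F.hST_of i hδF0 hδFc hMF (1 / 100) (by norm_num)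
  have hr49 : 21 / 25 * δF + (2 * (1 / 100) + 1 / 100) * δF ≤ (1 - 1 / 100) * δF := by nlinarith
  have hδC : (1 - 1 / 100) * δF ≤ (1 - 1 / 100) * δF := le_rfl
  have lowF := fun (A : ℝ) (w : (geo i).Site → ℝ) (hA : 0 ≤ A) (hw : ∀ a, 0 ≤ w a) {T₀ : Module.End ℝ (S i × ι → ℝ)}
      (hT : HasL2Majorant (g := toB6 (geo i) (F.Rr i) (F.Hp i)) (fun p : S i × ι => F.blk i p.1) T₀
        (fun a a' => A * w a * Real.exp (-(δF * (geo i).dist a a')))) =>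
    low A w hA hw (show (1 - 1 / 100) * δF ≤ δF by nlinarith) hT
  have h49 := ineq349_l2Hom_of_readings (R := F.Rr i) (H := F.Hp i) b (F.T i) (F.coord i U) (F.blk i) (F.d261 δF) ((((geo i).eta : ℂ))⁻¹)
    δF ((1 - 1 / 100) * δF) (1 / 100) (1 / 100) (21 / 25 * δF) ΛF BG δF (1 / 100) ΛC0 F.κc2 F.κs2 BC (F.wc i) (F.ws i)
    hBG0 hΛF1 (by positivity) (by norm_num) (by norm_num) hδF0.le hr49 F.κc2_nonneg F.κs2_nonneg hBC0 hΛC00 (F.ws_nonneg i) (F.hprod i) hδC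
    (F.dist_nonneg i) (F.triangle i) (F.len_pos i) (h261F (1 / 100) (by norm_num) (by norm_num)) f1 f2 f4 (hTCF (1 / 100) (by norm_num))
    (lowF BG _ hBG0 hw2 hG0) (fun μ => lowF BG _ hBG0 hw1 (hG1 μ)) (fun ν => lowF BG _ hBG0 hw1 (hG2 ν)) (F.hQc2 i U) (F.hQcs2 i U) h348F
  obtain ⟨hP, hDP, hPDs⟩ := h49
  -- ★ (3.77) for the concrete P₁(A)
  obtain ⟨-, -, f1i, -, -, -⟩ := F.hST_of i hδF0 hδFc hMF (1 / 100) (by norm_num)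
  have hr77 : 4 / 5 * δF + 2 * ((1 / 100 + 1 / 100) * δF) ≤ 21 / 25 * δF := by nlinarith
  have h77 := ineq377_l2_concreteE (Rr := F.Rr i) (H := F.Hp i) b (F.T i) (F.coord i U) (F.blk i) (F.d261 δF) δF (21 / 25 * δF) (1 / 100) (1 / 100)
    (4 / 5 * δF) ΛF KP KPp α₁ F.d₀ F.M₂ hKP0 hKPp0 hα₁.le hΛF1 (by positivity) (by norm_num) (by norm_num) hδF0.le (by positivity) F.M₂_nonneg
    hr77 (F.dist_nonneg i) (F.triangle i) (F.len_pos i) (h261F (1 / 100) (by norm_num) (by norm_num)) f1i F.hrepr (F.eta_pos i) (F.unitary i U)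
    (F.expA i U U') hA (fun ν x => hAτ ν ν x) hsmall4 (F.stencilF i) (F.stencilB i) hP hDP hPDs hPp hDPp hPpDs hDPpDs
  -- the word IS `pOneConc` at the frame's letters; the constant at α₁ ≦ 1
  refine hasL2Majorant_mono (g := toB6 (geo i) (F.Rr i) (F.Hp i)) _ h77 fun a a' => ?_
  have hk : kappa377 cE KP KPp ΛF cFL α₁ ≤ κ₇ := by
    rw [hκ₇]; exact kappa377_le_one hcE0 hKP0 hKPp0 (zero_le_one.trans hΛF1) hcFL0 hα₁.le hα1
  have h0 : 0 ≤ α₁ * ((geo i).len a ^ 2)⁻¹ * Real.exp (-(4 / 5 * δF * (geo i).dist a a')) := by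
    have := inv_nonneg.mpr (hw2 a); positivity
  calc _ = kappa377 cE KP KPp ΛF cFL α₁ * (α₁ * ((geo i).len a ^ 2)⁻¹ * Real.exp (-(4 / 5 * δF * (geo i).dist a a'))) := by
        rw [hcE, hΛF, hcFL]; ring
    _ ≤ κ₇ * (α₁ * ((geo i).len a ^ 2)⁻¹ * Real.exp (-(4 / 5 * δF * (geo i).dist a a'))) := mul_le_mul_of_nonneg_right hk h0
    _ = _ := by ring

/-- **v3 ⇒ v2**: an `L2GFrame₃` yields an `L2GFrame₂` whose displayed (3.77) field is filled by the theorem `read377_of_l2GFrame₃`.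
[cite: Balaban1985BackgroundPropagators, (3.77) p.406 + Thm 3.4 p.400] -/
def L2GFrame₃.toL2GFrame₂ {GA : ∀ i, B9.KernelFamily (geo i) (bg i)} {Cinv : ∀ i, B9.SiteKernel (geo i) (bg i)}
    (F : L2GFrame₃ c35 geo bg Gp b κ S GA Cinv) : L2GFrame₂ c35 geo bg Gp b κ S GA Cinv :=
  { F with read377 := read377_of_l2GFrame₃ F }

/-- ★ **THE (3.46)-STEP OF SECT. B FOR G(U′U) FROM AN `L2GFrame₃`** — `stepL2Pos_of_l2GFrame₂` on `toL2GFrame₂`: all six `L²` members of Theorem 3.3 for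
G(U′U), kernel-free, with NO displayed printed inequality left in the `L²` dictionary.
[cite: Balaban1985BackgroundPropagators, Thm 3.4 p.400 + Thm 3.3 p.399 + (3.46) p.398 + (3.82)–(3.86) p.407 + (3.77) p.406] -/
theorem stepL2Pos_of_l2GFrame₃ {GA : ∀ i, B9.KernelFamily (geo i) (bg i)} {Cinv : ∀ i, B9.SiteKernel (geo i) (bg i)}
    (F : L2GFrame₃ c35 geo bg Gp b κ S GA Cinv) : StepL2Pos F.dB c35 geo bg Gp GA Cinv GA :=
  stepL2Pos_of_l2GFrame₂ F.toL2GFrame₂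

end Literature.MathematicalPhysics.QuantumFieldTheory.Balaban1983to89.B9SectBL2GStepAtLettersV3
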